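import Summits.ValiantsHypothesis.ValiantsHypothesis.Theorems.BinomialElusivePeelingLemmaGadgetBlockTops
import Summits.ValiantsHypothesis.ValiantsHypothesis.Theorems.BinomialElusivePeelingLemmaGadgetBlockBeta

/-!
# The block theta gadget, VIII: readings of a vertex-charge combination (§3g (E3), the `S⁻` side)

Helper for the crux stmt-ValiantsHypothesis-7391 (negative lane; `Cruxes/PeelingLemma/DETERMINISTIC-ALLX.md`
§3g/§3h (E3)).  After Abel summation (`arm_sides_sub_eq`) the difference of the two sides of a
gadget-restricted relation is a VERTEX-charge combination
`V = Σ_j Σ_{t<L} c j t · win (birth3 j) q (2q+t)` (charge `c j t` at vertex `t` of arm `j`; vertex `0`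
is `b`).  This file reads `V` on the letters, in the `ℕ`-indexed convention of the [E] file: a
private letter born at vertex `t₀` of arm `j` reads the alternating sum of `c j` over its life
`[t₀, t₀+2q]` (`vsum_apply_private`); `beta a` reads `Σ_j Σ_{t ≤ 2q - blockAge j a} (-1)^{t + blockAge j a} c j t`
(`vsum_apply_beta`); `beta' a` reads the alternating sums over `[no+2+blockAge j a, …+2q]`
(`vsum_apply_beta'`).  No Theses import.
-/

namespace Summit.ValiantsHypothesis.ValiantsHypothesis.Theorems.PeelingLemmaGadget

-- summit = sub-problem name (single-conjunct summit, D-0017 layout), so the namespace repeats it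
set_option linter.dupNamespace false

open scoped BigOperators
open Finset
open Summit.ValiantsHypothesis.ValiantsHypothesis.Theorems.PeelingLemmaWindow

variable {q R no : ℕ}

/-- One arm's vertex sum read at a letter born on that arm at the natural position `p₀`:
the alternating sum of the charges at the vertices `t` with `p₀ ≤ 2q+t ≤ p₀+2q`. -/
theorem arm_vsum_apply_born (j : Fin 5) (c : ℕ → ℤ) (L p₀ : ℕ) :
    ∑ t ∈ Finset.range L, c t * win (birth3 q R no j) q ((2 * q + t : ℕ) : ℤ) (birth3 q R no j (p₀ : ℤ)) =
      ∑ t ∈ (Finset.range L).filter (fun t => p₀ ≤ 2 * q + t ∧ 2 * q + t ≤ p₀ + 2 * q),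
        (-1) ^ (2 * q + t - p₀) * c t := by
  rw [Finset.sum_filter]
  refine Finset.sum_congr rfl fun t _ => ?_
  rw [win_apply_born (birth3_injective j)]
  by_cases h : p₀ ≤ 2 * q + t ∧ 2 * q + t ≤ p₀ + 2 * q
  · rw [if_pos ⟨by exact_mod_cast h.1, by push_cast; omega⟩, if_pos h,
      show (((2 * q + t : ℕ) : ℤ) - (p₀ : ℤ)).toNat = 2 * q + t - p₀ by omega]
    ring
  · rw [if_neg (fun h' => h ⟨by exact_mod_cast h'.1, by push_cast at h'; omega⟩), if_neg h, mul_zero]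

/-- **Private reading.**  In the gadget vertex sum, the private letter born at vertex `t₀`
(`1 ≤ t₀ ≤ no+1`) of arm `j` reads the alternating sum of `c j` over `t₀ ≤ t ≤ t₀ + 2q` (within the
`L` vertices). -/
theorem vsum_apply_private (c : Fin 5 → ℕ → ℤ) (L : ℕ) (j : Fin 5) {t₀ : ℕ} (h1 : 1 ≤ t₀)
    (h2 : t₀ ≤ no + 1) :
    (∑ j', ∑ t ∈ Finset.range L, c j' t * win (birth3 q R no j') q ((2 * q + t : ℕ) : ℤ)
        (birth3 q R no j ((2 * q + t₀ : ℕ) : ℤ))) =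
      ∑ t ∈ (Finset.range L).filter (fun t => t₀ ≤ t ∧ t ≤ t₀ + 2 * q), (-1) ^ (t - t₀) * c j t := by
  rw [Finset.sum_eq_single_of_mem j (Finset.mem_univ j)]
  · rw [arm_vsum_apply_born j (c j) L (2 * q + t₀)]
    have hf : (Finset.range L).filter (fun t => 2 * q + t₀ ≤ 2 * q + t ∧ 2 * q + t ≤ 2 * q + t₀ + 2 * q) =
        (Finset.range L).filter (fun t => t₀ ≤ t ∧ t ≤ t₀ + 2 * q) :=
      Finset.filter_congr fun t _ => by omega
    rw [hf]
    refine Finset.sum_congr rfl fun t _ => ?_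
    rw [show 2 * q + t - (2 * q + t₀) = t - t₀ by omega]
  · intro j' _ hj
    refine Finset.sum_eq_zero fun t _ => ?_
    rw [win_eq_zero_of_forall_ne _ q _ (birth3_private j (by push_cast; omega) (by push_cast; omega) hj),
      mul_zero]

/-- **Reading of a `b`-letter.**  `beta a` (born on arm `j` at `2q - blockAge j a`, alive at the
vertices `t ≤ 2q - blockAge j a` with sign `(-1)^{t + blockAge j a}`) reads
`Σ_j Σ_{t ≤ 2q - blockAge j a} (-1)^{t + blockAge j a} c j t`. -/
theorem vsum_apply_beta (c : Fin 5 → ℕ → ℤ) (L : ℕ) (a : Fin (2 * q + 1)) :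
    (∑ j, ∑ t ∈ Finset.range L, c j t * win (birth3 q R no j) q ((2 * q + t : ℕ) : ℤ) (GLetter.beta a)) =
      ∑ j, ∑ t ∈ (Finset.range L).filter
          (fun t => t ≤ 2 * q - ((blockAge q R j a : Fin (2 * q + 1)) : ℕ)),
        (-1) ^ (t + ((blockAge q R j a : Fin (2 * q + 1)) : ℕ)) * c j t := by
  refine Finset.sum_congr rfl fun j _ => ?_
  have hlt := (blockAge q R j a).isLt
  have hb : GLetter.beta a = birth3 q R no j ((2 * q - ((blockAge q R j a : Fin (2 * q + 1)) : ℕ) : ℕ) : ℤ) := by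
    rw [← birth3_beta_pos (q := q) (R := R) (no := no) j a]
    congr 1; push_cast [Nat.cast_sub (show ((blockAge q R j a : Fin (2 * q + 1)) : ℕ) ≤ 2 * q by omega)]; ring
  rw [hb, arm_vsum_apply_born j (c j) L]
  have hf : (Finset.range L).filter (fun t => 2 * q - ((blockAge q R j a : Fin (2 * q + 1)) : ℕ) ≤ 2 * q + t ∧
        2 * q + t ≤ 2 * q - ((blockAge q R j a : Fin (2 * q + 1)) : ℕ) + 2 * q) =
      (Finset.range L).filter (fun t => t ≤ 2 * q - ((blockAge q R j a : Fin (2 * q + 1)) : ℕ)) :=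
    Finset.filter_congr fun t _ => by omega
  rw [hf]
  refine Finset.sum_congr rfl fun t ht => ?_
  have := (Finset.mem_filter.mp ht).2
  congr 1
  -- exponents `2q + t - (2q - f)` and `t + f` have the same parity (indeed are equal)
  rw [show 2 * q + t - (2 * q - ((blockAge q R j a : Fin (2 * q + 1)) : ℕ)) =
      t + ((blockAge q R j a : Fin (2 * q + 1)) : ℕ) by omega]

/-- **Reading of a `b'`-letter.**  `beta' a` (born on arm `j` at vertex `no + 2 + blockAge j a`)
reads `Σ_j Σ_{no+2+blockAge j a ≤ t ≤ no+2+blockAge j a+2q, t<L} (-1)^{t-(no+2+blockAge j a)} c j t`. -/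
theorem vsum_apply_beta' (c : Fin 5 → ℕ → ℤ) (L : ℕ) (a : Fin (2 * q + 1)) :
    (∑ j, ∑ t ∈ Finset.range L, c j t * win (birth3 q R no j) q ((2 * q + t : ℕ) : ℤ) (GLetter.beta' a)) =
      ∑ j, ∑ t ∈ (Finset.range L).filter
          (fun t => no + 2 + ((blockAge q R j a : Fin (2 * q + 1)) : ℕ) ≤ t ∧
            t ≤ no + 2 + ((blockAge q R j a : Fin (2 * q + 1)) : ℕ) + 2 * q),
        (-1) ^ (t - (no + 2 + ((blockAge q R j a : Fin (2 * q + 1)) : ℕ))) * c j t := by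
  refine Finset.sum_congr rfl fun j _ => ?_
  have hlt := (blockAge q R j a).isLt
  have hb : GLetter.beta' a =
      birth3 q R no j ((2 * q + (no + 2 + ((blockAge q R j a : Fin (2 * q + 1)) : ℕ)) : ℕ) : ℤ) := by
    rw [← birth3_beta'_pos (q := q) (R := R) (no := no) j a]
    congr 1; push_cast; ring
  rw [hb, arm_vsum_apply_born j (c j) L]
  have hf : (Finset.range L).filter (fun t =>
        2 * q + (no + 2 + ((blockAge q R j a : Fin (2 * q + 1)) : ℕ)) ≤ 2 * q + t ∧
        2 * q + t ≤ 2 * q + (no + 2 + ((blockAge q R j a : Fin (2 * q + 1)) : ℕ)) + 2 * q) =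
      (Finset.range L).filter (fun t => no + 2 + ((blockAge q R j a : Fin (2 * q + 1)) : ℕ) ≤ t ∧
            t ≤ no + 2 + ((blockAge q R j a : Fin (2 * q + 1)) : ℕ) + 2 * q) :=
    Finset.filter_congr fun t _ => by omega
  rw [hf]
  refine Finset.sum_congr rfl fun t ht => ?_
  have := (Finset.mem_filter.mp ht).2
  rw [show 2 * q + t - (2 * q + (no + 2 + ((blockAge q R j a : Fin (2 * q + 1)) : ℕ))) =
      t - (no + 2 + ((blockAge q R j a : Fin (2 * q + 1)) : ℕ)) by omega]

end Summit.ValiantsHypothesis.ValiantsHypothesis.Theorems.PeelingLemmaGadget
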